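import Mathlib
import Summits.Ventures.PercRepro2.LeafHalfCross
import Summits.Ventures.PercRepro2.LeafHalfCrossRed

/-!
# The symmetric three-point candidate «(AA0)» for row (LEAF-½) (blind cell PercRepro2, p5 g26;
`proofs/P5-OEDGE.md` §33 addendum 2, `proofs/subclaims/S4-HARDSTEP.md` v108)

`LeafHalfCrossRed.Rhalf_eq_four` writes the a₃-leaf middle coefficient as
`R½ = (P(Q) − m_v)·[anticov(oH, bL) + anticov(oL, bH)] + (crossA + crossA′) + (crossB + crossB′)`,
where the margin and the two (B)-terms are theorems (`mU_le_Q`, `anticov_nonneg_of_cross`,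
`crossB_nonneg`) and the two (A)-terms are of either sign.  The candidate **(AA0)** is the
statement that the two (A)-terms are **jointly** nonnegative:

  `0 ≤ crossAA := crossA + crossA′`, i.e.
  `E_Q[(L_b − β)(L_o − l)·H_v] + E_Q[(H_b − β′)(H_o − c)·L_v] ≥ 0`

(`β = ⟨L_b⟩`, `l = ⟨L_o⟩`, `β′ = ⟨H_b⟩`, `c = ⟨H_o⟩`, all under `Q = {a₁ ↮ a₂}`): the positive-association
deficit of the two `C₁`-events in the world `v ∈ C₂` is paid by the surplus of the two `C₂`-events in
the world `v ∈ C₁`.  It is symmetric under the exchange of the roots, strictly stronger than the margin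
form `LeafRow_of_crossA` asks for, and implies the row outright (`LeafRow_of_AA0`).  In cleared masses
(`crossAA_eq`, with `Z = P(Q)` and `m(X) = P(Q, X)`):

  `crossAA = Z²·[m(vH, oL, bL) + m(vL, oH, bH)]
             − Z·[m(bL)·m(vH, oL) + m(oL)·m(vH, bL) + m(bH)·m(vL, oH) + m(oH)·m(vL, bH)]
             + [m(bL)·m(oL)·m(vH) + m(bH)·m(oH)·m(vL)]`.

Status (numbers, not proof): (AA0) was never violated on 59,945 ES climbs of the row adversary at
`n ≤ 8` (kit j312929, minimum of the objective exactly `0`) and its tensor-Bernstein coefficients are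
nonnegative on 47,838 multiplicity classes at `n ≤ 6`; a single (A)-term can be negative (exact witness in
`proofs/P5-OEDGE.md` §32: there `crossA = −1.07·10⁻⁶·Z³` against `crossA′ = +3.36·10⁻⁵·Z³`).
Nothing in this file claims `0 ≤ crossAA`.
-/

namespace Summit.Ventures.PercRepro2

open UnionCluster CovForm PendantRoot LeafStep

namespace LeafHalfCross

variable {V : Type*} {E : Type*} [Fintype E] [DecidableEq E] [Fintype V] [DecidableEq V]
  {R : Type*} [Field R] [LinearOrder R] [IsStrictOrderedRing R]

section AA0

variable (p : E → R) (ends : E → Sym2 V)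

/-- **`crossAA = crossA + crossA′`** — the symmetric sum of the two (A)-terms of `R½`
(`= Z³·(E_Q[(L_b − β)(L_o − l) H_v] + E_Q[(H_b − β′)(H_o − c) L_v])`); the candidate (AA0) is `0 ≤ crossAA`. -/
noncomputable def crossAA (o a₁ a₂ v b : V) : R :=
  crossA p ends o a₁ a₂ v b + crossA p ends o a₂ a₁ v b

omit [Fintype V] [DecidableEq V] [LinearOrder R] [IsStrictOrderedRing R] in
/-- **The symmetric eight-term form of `crossAA`** in the cleared `Q`-masses
(`Z = P(Q)`, `m(X) = P(Q, X)`, the mirror written through `avoidAll_root_swap`). -/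
theorem crossAA_eq (o a₁ a₂ v b : V) :
    crossAA p ends o a₁ a₂ v b =
      prob p (avoidAll ends a₂ {a₁}) ^ 2 *
          (prob p (avoidAll ends a₂ {a₁} ∩
              (connEvent ends a₂ v ∩ (connEvent ends a₁ o ∩ connEvent ends a₁ b))) +
            prob p (avoidAll ends a₂ {a₁} ∩
              (connEvent ends a₁ v ∩ (connEvent ends a₂ o ∩ connEvent ends a₂ b)))) -
        prob p (avoidAll ends a₂ {a₁}) *
          (prob p (avoidAll ends a₂ {a₁} ∩ connEvent ends a₁ b) *
              prob p (avoidAll ends a₂ {a₁} ∩ (connEvent ends a₂ v ∩ connEvent ends a₁ o)) +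
            prob p (avoidAll ends a₂ {a₁} ∩ connEvent ends a₁ o) *
              prob p (avoidAll ends a₂ {a₁} ∩ (connEvent ends a₂ v ∩ connEvent ends a₁ b)) +
            prob p (avoidAll ends a₂ {a₁} ∩ connEvent ends a₂ b) *
              prob p (avoidAll ends a₂ {a₁} ∩ (connEvent ends a₁ v ∩ connEvent ends a₂ o)) +
            prob p (avoidAll ends a₂ {a₁} ∩ connEvent ends a₂ o) *
              prob p (avoidAll ends a₂ {a₁} ∩ (connEvent ends a₁ v ∩ connEvent ends a₂ b))) +
        (prob p (avoidAll ends a₂ {a₁} ∩ connEvent ends a₁ b) *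
            prob p (avoidAll ends a₂ {a₁} ∩ connEvent ends a₁ o) *
            prob p (avoidAll ends a₂ {a₁} ∩ connEvent ends a₂ v) +
          prob p (avoidAll ends a₂ {a₁} ∩ connEvent ends a₂ b) *
            prob p (avoidAll ends a₂ {a₁} ∩ connEvent ends a₂ o) *
            prob p (avoidAll ends a₂ {a₁} ∩ connEvent ends a₁ v)) := by
  unfold crossAA crossA anticov
  simp only [avoidAll_root_swap ends a₁ a₂]
  ring

/-- **Row (LEAF-½) from (AA0)**: `0 ≤ crossAA → LeafRow` — the margin
`(P(Q) − m_v)·[anticov(oH, bL) + anticov(oL, bH)]` is nonnegative (`mU_le_Q`, BHK06 1.4), so the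
hypothesis of `LeafRow_of_crossA` follows. -/
theorem LeafRow_of_AA0 (hp : IsProbVec p) (o a₁ a₂ v b : V)
    (h : 0 ≤ crossAA p ends o a₁ a₂ v b) : LeafRow p ends o a₁ a₂ v b := by
  apply LeafRow_of_crossA p ends hp o a₁ a₂ v b
  have hm := mU_le_Q p ends hp a₁ a₂ v
  have h1 := anticov_nonneg_of_cross' p ends hp a₁ a₂ o b
  have h2 := anticov_nonneg_of_cross p ends hp a₁ a₂ o b
  have hmargin : 0 ≤ (prob p (avoidAll ends a₂ {a₁}) - mU p ends a₁ a₂ v) *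
      (anticov p ends a₁ a₂ (connEvent ends a₂ o) (connEvent ends a₁ b) +
        anticov p ends a₁ a₂ (connEvent ends a₁ o) (connEvent ends a₂ b)) :=
    mul_nonneg (sub_nonneg.2 hm) (add_nonneg h1 h2)
  unfold crossAA at h
  linarith

omit [Fintype V] [DecidableEq V] in
/-- **(AA0) from the two (A)-terms separately**: `0 ≤ crossA → 0 ≤ crossA′ → 0 ≤ crossAA`
(the single terms can be negative — the witness of `proofs/P5-OEDGE.md` §32 — so this is the easy
direction only). -/
theorem crossAA_nonneg_of_crossA (o a₁ a₂ v b : V) (hL : 0 ≤ crossA p ends o a₁ a₂ v b)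
    (hH : 0 ≤ crossA p ends o a₂ a₁ v b) : 0 ≤ crossAA p ends o a₁ a₂ v b := by
  unfold crossAA
  exact add_nonneg hL hH

omit [Fintype V] in
/-- **`R½` and the two candidates together**: `R½ = margin + crossAA + (crossB + crossB′)`, so
`R½ ≥ crossAA` and (AA0) is exactly «`R½` minus its theorem-signed part is nonnegative». -/
theorem Rhalf_eq_margin_add_crossAA (o a₁ a₂ v b : V) :
    Rhalf p ends o a₁ a₂ v b =
      (prob p (avoidAll ends a₂ {a₁}) - mU p ends a₁ a₂ v) *
          (anticov p ends a₁ a₂ (connEvent ends a₂ o) (connEvent ends a₁ b) +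
            anticov p ends a₁ a₂ (connEvent ends a₁ o) (connEvent ends a₂ b)) +
        crossAA p ends o a₁ a₂ v b +
        (crossB p ends o a₁ a₂ v b + crossB p ends o a₂ a₁ v b) := by
  rw [Rhalf_eq_four]
  unfold crossAA
  ring

end AA0

end LeafHalfCross

end Summit.Ventures.PercRepro2
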